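import Literature.IUT.HodgeTheaters.ThetaPMEllHodgeTheaters
import Literature.IUT.HodgeTheaters.BaseThetaDatumModel

/-!
# [IUTchI] §6, Remark 6.12.2 (ii): the uniqueness of the gluing isomorphism needs `𝕍^bad ≠ ∅` — kernel witness

Mochizuki, *Inter-universal Teichmüller theory I*, §6, Remark 6.12.2 (ii) p. 174 ("by Proposition 4.8,
(ii); Corollary 5.6, (ii), the gluing isomorphism that occurs in such a gluing operation is unique")
and Definition 3.1 (b) p. 61 ("`𝕍^bad_mod` … a NONEMPTY set of nonarchimedean valuations"), kurims
manuscript (May 2020) ([IUTchI] Rmk 6.12.2 (ii) p.174) [claim: Mochizuki2012, status: disputed].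

WITNESS (consistency analysis of the typed statement, no IUT content): the named statement
`S5Local.GluingUnique` of `ThetaPMEllHodgeTheaters.lean` (abc-iut-L5-t4) quantifies over every kit; in
a kit instance with `𝕍^bad = ∅` (the tree's `toyKit`, `l = 5`) Proposition 6.7's `𝒟-Θ`-bridge
poly-morphisms at the (good) place are FULL, so EVERY permutation of `T^⋇` is a gluing of the model
Θ^±-bridge to a ΘNF-side datum built from it, and `GluingUnique` FAILS there (`not_gluingUnique_toy`).
Hence consumers must take `GluingUnique` together with `K.bad.Nonempty` (Def 3.1 (b)), where the labels
`∈ 𝔽_l^⋇` of Example 4.4 live (Prop 4.7 (i), 4.8 (ii)) — the guarded form `GluingUniqueBad` of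
`ThetaPMEllNFHodgeTheatersIso.lean` (abc-iut-L5-t5). Analysis endorsed by L5-lead 2026-08-25T22:59:13Z.
-/

namespace Literature.IUT.HodgeTheaters

open CategoryTheory

namespace PMBaseKit

namespace GluingWitness

variable (l : ℕ) [Fact l.Prime] (hl : l ≠ 2)

/-- The model `ℱ`-prime-strip of the toy `ℱ`-kit (every constituent the model object).
([IUTchI] Def 5.2 (i) p.134) [claim: Mochizuki2012, status: disputed] -/
noncomputable def strip : (FKit.toy l hl).FStrip := ⟨fun _ => Model.Obj.loc, fun _ => ⟨Iso.refl _⟩⟩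

/-- Example 6.2's model Θ^±-bridge over the toy kits, as a Θ^±-bridge of `ℱ`-prime-strips (all
constituents the model strip; `T = 𝔽_l` tautological). ([IUTchI] Ex 6.2 (i) p.160) [claim: Mochizuki2012, status: disputed] -/
noncomputable def bridge : (FKit.toy l hl).ThetaPMBridge :=
  haveI : NeZero l := ⟨(Fact.out : l.Prime).ne_zero⟩
  { T := ZMod l
    grpT := FlPMGroup.tautological l
    capsule := fun _ => strip l hl
    codomain := strip l hl
    dPoly := Ex62.poly (toyKit l hl)
    dPoly_model := (Ex62.bridge (toyKit l hl)).exists_model }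

/-- A ΘNF-side kit over the toy kits whose single ΘNF-Hodge theater has, as Θ-bridge portion, EXACTLY
Proposition 6.7's output for `bridge` (index set `T^⋇`, capsule `†𝔉_{T^⋇}`, `‡𝔉_> := †𝔉_≻`, the same
`𝒟-Θ`-bridge poly-morphisms) — "the portion `‡𝔉_J → ‡𝔉_>` … obtained via the functorial algorithm … from
the Θ^±-bridge" ([IUTchI] Rmk 6.12.2 (i) p. 174). ([IUTchI] Rmk 6.12.2 (i) p.174) [claim: Mochizuki2012, status: disputed] -/
noncomputable def nfKit (hl' : Odd l) : (toyKit l hl).S5Local (MultKit.toy l hl) (FKit.toy l hl) where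
  CatAmb := SingleObj (Model.AGL l)
  nfAtV _ := Model.atV' l
  IsDThetaNFHT _ _ _ := True
  ThetaNFHT := PUnit
  thJ _ := (bridge l hl).grpT.AbsStar
  thCapsule _ q := (bridge l hl).starCapsule q
  thFgt _ := (bridge l hl).codomain
  thDPoly _ q v := ((bridge l hl).dBridge.thetaBridgeData (MultKit.toy l hl) hl').poly ⟨q⟩ v

/-- In the toy kit every place is good (`𝕍^bad = ∅`). [folklore] -/
private theorem not_mem_bad (v : (toyKit l hl).V) : v ∉ (toyKit l hl).bad := by
  change v ∉ (∅ : Finset (toyKit l hl).V)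
  simp

/-- With `𝕍^bad = ∅`, EVERY permutation `σ` of `T^⋇` is a gluing of the ΘNF-side datum to `bridge`:
Proposition 6.7's poly-morphisms at good places are full, hence compatible with anything full.
([IUTchI] Rmk 6.12.2 (i) p.174) [claim: Mochizuki2012, status: disputed] -/
noncomputable def gluingOfPerm (hl' : Odd l) (σ : Equiv.Perm (bridge l hl).grpT.AbsStar) :
    (nfKit l hl hl').ThetaGluing (bridge l hl) PUnit.unit hl' where
  indexEquiv := σ
  compat := by
    intro j v
    have hv := not_mem_bad l hl v
    ext h
    simp only [nfKit, FKit.ThetaPMBridge.dBridge, DThetaPMBridge.thetaBridgeData, dif_neg hv]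
    constructor
    · rintro ⟨φ, g, ⟨f, rfl⟩, rfl⟩
      exact ⟨(φ ≪≫ f).hom, Iso.refl _, ⟨φ ≪≫ f, rfl⟩, by simp⟩
    · rintro ⟨f, ψ, ⟨f', rfl⟩, rfl⟩
      refine ⟨f' ≪≫ ψ, (Iso.refl _).hom, ⟨Iso.refl _, rfl⟩, ?_⟩
      simp only [Iso.trans_hom, Iso.refl_hom]
      exact (Category.comp_id _).symm

/-- Hence `GluingUnique` FAILS for this kit instance as soon as `T^⋇` has a non-identity permutation:
two distinct gluings. ([IUTchI] Rmk 6.12.2 (ii) p.174) [claim: Mochizuki2012, status: disputed] -/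
theorem not_gluingUnique_of_perm (hl' : Odd l) (σ : Equiv.Perm (bridge l hl).grpT.AbsStar) (hσ : σ ≠ 1) :
    ¬ (nfKit l hl hl').GluingUnique hl' := by
  intro hU
  have h := (hU (bridge l hl) PUnit.unit).elim (gluingOfPerm l hl hl' σ) (gluingOfPerm l hl hl' 1)
  exact hσ (congrArg S5Local.ThetaGluing.indexEquiv h)

/-- In the tautological `𝔽_l^±`-group, `zero = 0`. [folklore] -/
private theorem tautological_zero : (FlPMGroup.tautological l).zero = 0 := by
  have h := (FlPMGroup.tautological l).chart_zero (e := signPerm l 1) ⟨1, rfl⟩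
  simpa using h

/-- In the tautological `𝔽_l^±`-group, `neg t = -t`. [folklore] -/
private theorem tautological_neg (t : ZMod l) : (FlPMGroup.tautological l).neg t = -t := by
  have h := (FlPMGroup.tautological l).chart_neg (e := signPerm l 1) ⟨1, rfl⟩ t
  simpa using h

/-- Classes in `|𝔽_l|`: `|a| = |b|` iff `b = a` or `b = −a`. [folklore] -/
private theorem toAbs_eq_iff (a b : ZMod l) :
    (FlPMGroup.tautological l).toAbs a = (FlPMGroup.tautological l).toAbs b ↔ b = a ∨ b = -a := by
  rw [← tautological_neg l]
  constructor
  · intro h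
    exact Quotient.exact h
  · intro h
    exact Quotient.sound h

end GluingWitness

/-! ### The instance `l = 5` -/

namespace GluingWitness

/-- The class of `1` in `𝔽_5^⋇ = |𝔽_5| ∖ {0}` (witness plumbing). ([IUTchI] Def 6.4 (i) p.162) [claim: Mochizuki2012, status: disputed] -/
noncomputable def one5 : (bridge 5 (by decide)).grpT.AbsStar :=
  ⟨(FlPMGroup.tautological 5).toAbs 1, by
    change (FlPMGroup.tautological 5).toAbs 1 ≠ (FlPMGroup.tautological 5).toAbs (FlPMGroup.tautological 5).zero
    rw [tautological_zero, Ne, toAbs_eq_iff]; decide⟩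

/-- The class of `2` in `𝔽_5^⋇` (witness plumbing). ([IUTchI] Def 6.4 (i) p.162) [claim: Mochizuki2012, status: disputed] -/
noncomputable def two5 : (bridge 5 (by decide)).grpT.AbsStar :=
  ⟨(FlPMGroup.tautological 5).toAbs 2, by
    change (FlPMGroup.tautological 5).toAbs 2 ≠ (FlPMGroup.tautological 5).toAbs (FlPMGroup.tautological 5).zero
    rw [tautological_zero, Ne, toAbs_eq_iff]; decide⟩

/-- `|1| ≠ |2|` in `|𝔽_5|`. [folklore] -/
private theorem one5_ne_two5 : one5 ≠ two5 := by
  intro h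
  have h' := congrArg Subtype.val h
  change (FlPMGroup.tautological 5).toAbs 1 = (FlPMGroup.tautological 5).toAbs 2 at h'
  rw [toAbs_eq_iff] at h'
  revert h'
  decide

/-- **Witness**: over the tree's toy kits with `l = 5` (so `𝕍^bad = ∅`, `|T^⋇| = 2`) and the ΘNF-side
datum `nfKit`, the named statement `S5Local.GluingUnique` of `ThetaPMEllHodgeTheaters.lean` is FALSE —
the uniqueness of [IUTchI] Rmk 6.12.2 (ii) genuinely uses `𝕍^bad ≠ ∅` (Def 3.1 (b)); cf. the guarded
`GluingUniqueBad`. ([IUTchI] Rmk 6.12.2 (ii) p.174) [claim: Mochizuki2012, status: disputed] -/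
theorem not_gluingUnique_toy :
    ¬ (nfKit 5 (by decide) ⟨2, rfl⟩).GluingUnique ⟨2, rfl⟩ := by
  classical
  exact not_gluingUnique_of_perm 5 (by decide) ⟨2, rfl⟩ (Equiv.swap one5 two5) fun h =>
    one5_ne_two5 (by simpa using (congrArg (fun σ => σ one5) h).symm)

end GluingWitness

end PMBaseKit

end Literature.IUT.HodgeTheaters
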